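/-
Copyright (c) 2026 the pub-hodgecm-mathlib formalisation cell (harness21).  Prover seat hodgecm-mathlib-LH7-p09 (g0), re-dealt by director s1969 (a) to strike line L3
`stub_N6nsDyadic` (Track A «(D-RAM) FOUR-FRAME» squad F0∕P3c∕LH4; heir LEAD F0P3a-plan (g21), β sub-dealer LH4-p05 (g8) β-BOARD v1 row R4 «G₂ ε-BOUNDARY TOWER FILE»,
✋ 15:26:32Z); helper lane on h413 = stmt-HodgeConjecture-24833 (count-neutral).  2026-09-04.
-/
import Summits.HodgeConjecture.HodgeConjecture.Theorems.F0P3cDyRamLabelledOddSwapEngine        -- ★ p861439 (LH4-p18 (g0)): `finsum_stratum_shell_labelledOdd_div_relIndex_swap01_of` (the (0 1)-swap engine); brings ★ §P kits, ★ DEFS `…LabelledOddCountDefs`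
import Summits.HodgeConjecture.HodgeConjecture.Theorems.F0P3cDyRamStageOneBDerivedDefs        -- ★ p859675: `n0DerivedOfRecord`; brings ★ `…StageOneBDefs` (`mcOfRecord`), ★ `…FourFramePieces` (`mstarOfRecord`)
import HarnessLib

/-!
# Crux `H413`, line LH4 «(D-RAM) FOUR-FRAME» — (β) table, β-BOARD row R4: THE `G₂ = (2ρ+s, 2ρ, 2ρ+s)` CAPPED TUBE CLASSES BEYOND THE ONE-SLOT CELL, FROM ROW R3 BY THE
# (0 1)-SWAP — `hG2b` of ★ (T1) p861261 as the swap-image of `hG1b`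

Cell `hodgecm-mathlib` (D-0151), FLOOR 0, crux item H413 = `stmt-HodgeConjecture-24833`, route `HCCMUnconditional`; squad F0∕P3c∕LH4.  THEOREMS ONLY (no `def`, no instance, no
notation, no `sorry`, default heartbeats); ★-only imports; lane `--supports stmt-HodgeConjecture-24833 --as helper`; pays NO row, states NO law.

WHY.  In F0P3a-p01 (g37)'s (T1) ★ p861261 `OddLabelledBoxSum` the binder `hG2b` — the tower-2 glued strata `![2ρ+s, 2ρ, 2ρ+s]` BEYOND the one-slot cell (`n₁ < 2ρ + m*`),
on the read `2ρ + s + ℓ₀ = n₂`, `2 ∣ s`, under the cap `2ρ + 2 + ℓ₀ ≤ min n₁ n₃`, value `ω_A∕2 · q^{2ρ+s∕2−1} · (F(n₁), 0, ω(−1)·F(n₃))_i` with the per-slot twist factor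
`F(n) = (q−1)·[2d + ℓ₀ + 2ρ ≤ n] − [n + 2 = 2d + ℓ₀ + 2ρ]` — is the `(0 1)`-image of `hG1b` (row R3, LH4-p17 (g0): the `G₁ = ![2ρ, 2ρ+s, 2ρ+s]` classes with `n₂ < 2ρ + m*`,
read `2ρ + s + ℓ₀ = n₁`, cap on `min n₂ n₃`, token `e_B` of `β − 1`, value `ω_B∕2 · q^{…} · (0, F(n₂), ω(−1)·F(n₃))_i`).  LH4-p18 (g0)'s ★ p861439 (0 1)-SWAP ENGINE
`finsum_stratum_shell_labelledOdd_div_relIndex_swap01_of` transports ANY such G₁-statement, uniform in the element datum and carrying a witness `w` (here the tower-sign token),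
to the swapped stratum at the swapped datum `(β, α; n₂, n₁, n₃)` (★ `isElementDatum_swap`): the label `valueClassLabel σ ϖ (α−1) (β−1) m* d` and the three clean-shell tokens
are `(0 1)`-symmetric, the slot moves by `Equiv.swap 0 1`.  So R4 ⟸ R3 with NO member transport: the token of `β' − 1 = α − 1` at depth `n₁' = n₂` is `e_A` (★ p860780 `heA`
verbatim), `F(n₂') = F(n₁)`, and `(0, F(n₁), ω(−1)F(n₃))_{swap 0 1 i} = (F(n₁), 0, ω(−1)F(n₃))_i`.  THIS FILE is that adapter, with R3 as an explicit ∀-hypothesis `hR3` in LH4-p17's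
SIG-R3-BoundaryG1 v1 (91f4458d) letters (binder for binder: `T' eB hE' hT' hbey hread hpar hcap hσeB heB1 heB i`), so that the (T2) TRUNK's `hP3G2` is
`finsum_stratum_G2_beyond_shell_labelledOdd_div_relIndex_eq_of_G1 (fun T' eB hE' hT' … => ‹R3› h2 hD hE' T' hT' ρ s hρ …) …` the minute R3 is ★ — and is ★-checkable NOW.
HONEST LABEL.  Count-neutral transport; R3 is a HYPOTHESIS here (LH4-p17 (g0), in flight); table∕(β-BAL)∕(β)∕T₊ row OPEN; `HC_CM` is proved only modulo the 7 printed citations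
(2 remaining named inputs: hLiu418 = `stmt-HodgeConjecture-24832`, h413 = `stmt-HodgeConjecture-24833`) until rung 0 closes.  Nothing printed is asserted.

## References
* [Kottwitz1986BaseChangeUnits] R. E. Kottwitz, *Base change for unit elements of Hecke algebras*, Compositio Math. 60 (1986), §1 pp. 240–241 (signed lattice counts by strata; coordinate symmetry).
* [Rogawski1990] J. D. Rogawski, *Automorphic Representations of Unitary Groups in Three Variables*, Ann. of Math. Stud. 123 (1990), §4.9 Prop. 4.9.1 (a)(b) p. 55, §4.10 p. 58.
* [LanglandsShelstad1987] R. P. Langlands, D. Shelstad, *On the definition of transfer factors*, Math. Ann. 278 (1987), §3 (the characters `(ℤ∕2)³`, permuted slots).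
-/

set_option autoImplicit false

noncomputable section

namespace Summit.HodgeConjecture.HodgeConjecture.Cruxes.H413.F0P3cDyRamLabelledOddBoundaryG2OfG1

open Matrix
open Literature.NumberTheory.Automorphic Literature.NumberTheory.Automorphic.HermitianLattice
open Literature.NumberTheory.Automorphic.UnitaryLatticeTree Literature.NumberTheory.Automorphic.UnitaryThreeFourFrame
open Summit.HodgeConjecture.HodgeConjecture.Cruxes.H413.F0P3cDyRamFourFramePieces (mstarOfRecord)
open Summit.HodgeConjecture.HodgeConjecture.Cruxes.H413.F0P3cDyRamFourFrameCensusDefs (LatticeInLevel)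
open Summit.HodgeConjecture.HodgeConjecture.Cruxes.H413.F0P3cDyRamStageOneBDefs (mcOfRecord)
open Summit.HodgeConjecture.HodgeConjecture.Cruxes.H413.F0P3cDyRamStageOneBDerivedDefs (n0DerivedOfRecord)
open Summit.HodgeConjecture.HodgeConjecture.Cruxes.H413.F0P3cDyRamDiagonalTorusDefs
open Summit.HodgeConjecture.HodgeConjecture.Cruxes.H413.F0P3cDyRamDiagonalStrataDefs
open Summit.HodgeConjecture.HodgeConjecture.Cruxes.H413.F0P3cDyRamLabelledOddCountDefs
open Summit.HodgeConjecture.HodgeConjecture.Cruxes.H413.F0P3cDyRamLabelledOddSwapEngine (finsum_stratum_shell_labelledOdd_div_relIndex_swap01_of)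
open scoped Valued WithZero Matrix MatrixGroups

variable {K : Type} [Field K] [Valued K ℤᵐ⁰] [CompleteSpace K] [Fintype 𝓀[K]] {σ : K →+* K} {ϖ : K} {d t : ℕ} {α β : K} {n₁ n₂ n₃ : ℕ}

omit [CompleteSpace K] in
/-- **β-BOARD R4 FROM R3 — THE `G₂ = (2ρ+s, 2ρ, 2ρ+s)` CAPPED TUBE CLASSES BEYOND THE ONE-SLOT CELL** (`n₁ < 2ρ + m*`, read `2ρ + s + ℓ₀ = n₂`, `2 ∣ s`, cap
`2ρ + 2 + ℓ₀ ≤ min n₁ n₃`, token `e_A` of `α − 1` at depth `n₂`):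
`Σᶠ_{M ∈ stratum G₂, clean shell} labelledOddCount σ ϖ 0 i Λ M ∕ [𝒰 : N(S̃′(M))] = ω(e_A)∕2 · q^{2ρ+s∕2−1} · (F(n₁), 0, ω(−1)·F(n₃))_i` — (T1) ★ p861261 `hG2b` RHS VERBATIM —
GIVEN row R3 (the `G₁` twin, LH4-p17 (g0) SIG-R3-BoundaryG1 v1, as the ∀-hypothesis `hR3` over the element datum at the derived threshold and its token): ★ p861439
`finsum_stratum_shell_labelledOdd_div_relIndex_swap01_of` at the swapped datum `(β, α; n₂, n₁, n₃)`, witness `e_A`, then `(0, a, b)_{swap 0 1 i} = (a, 0, b)_i`.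
[cite: Kottwitz1986BaseChangeUnits, §1 pp. 240–241] [cite: Rogawski1990, §4.9 Prop. 4.9.1 (a)(b) p. 55] [cite: LanglandsShelstad1987, §3] -/
theorem finsum_stratum_G2_beyond_shell_labelledOdd_div_relIndex_eq_of_G1 {ρ s : ℕ}
    (hR3 : ∀ {α' β' : K} {n₁' n₂' n₃' : ℕ} (T' : GL (Fin 3) K) (eB : K), IsElementDatum σ ϖ (n0DerivedOfRecord d) α' β' n₁' n₂' n₃' →
      (T' : Matrix (Fin 3) (Fin 3) K) = Matrix.diagonal ![α', β', 1] →
      n₂' < 2 * ρ + mstarOfRecord d → 2 * ρ + s + d % 2 = n₁' → 2 ∣ s → 2 * ρ + 2 + d % 2 ≤ min n₂' n₃' →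
      σ eB = eB → Valued.v eB = 1 →
      Valued.v ((ϖ ^ mstarOfRecord d)⁻¹ * ((β' - 1) * ((ϖ * σ ϖ) ^ ((n₁' - d % 2) / 2))⁻¹ - eB * ((ϖ - σ ϖ) * ((ϖ * σ ϖ) ^ ((d - d % 2) / 2))⁻¹))) ≤ 1 →
      ∀ i : Fin 3,
        ∑ᶠ M ∈ {M : Submodule 𝒪[K] (Fin 3 → K) | M ∈ stratum σ ϖ T' ![2 * ρ, 2 * ρ + s, 2 * ρ + s] ∧
            (LatticeInLevel ϖ (d % 2) (Matrix.diagonal ![α' - 1, β' - 1, 0]) M ∧ ¬ LatticeInLevel ϖ (d % 2 + 1) (Matrix.diagonal ![α' - 1, β' - 1, 0]) M ∧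
              LatticeInLevel ϖ (mcOfRecord d) (Matrix.diagonal ![(α' - 1) * (α' - 1), (β' - 1) * (β' - 1), 0]) M)},
          (labelledOddCount σ ϖ 0 i (valueClassLabel σ ϖ (α' - 1) (β' - 1) (mstarOfRecord d) d) M : ℚ) /
            ((((unitStabilizer M).map (unitNormMap σ 3)).relIndex (fixedUnitTorus σ 3) : ℕ) : ℚ) =
          (normSign σ eB : ℚ) / 2 * (Fintype.card 𝓀[K] : ℚ) ^ (2 * ρ + s / 2 - 1) *
            (![(0 : ℚ), ((if 2 * d + d % 2 + 2 * ρ ≤ n₂' then (Fintype.card 𝓀[K] : ℚ) - 1 else 0) - (if n₂' + 2 = 2 * d + d % 2 + 2 * ρ then 1 else 0)),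
                (normSign σ (-1 : K) : ℚ) * ((if 2 * d + d % 2 + 2 * ρ ≤ n₃' then (Fintype.card 𝓀[K] : ℚ) - 1 else 0) -
                  (if n₃' + 2 = 2 * d + d % 2 + 2 * ρ then 1 else 0))] : Fin 3 → ℚ) i)
    (hE : IsElementDatum σ ϖ (n0DerivedOfRecord d) α β n₁ n₂ n₃)
    (T : GL (Fin 3) K) (hT : (T : Matrix (Fin 3) (Fin 3) K) = Matrix.diagonal ![α, β, 1])
    (hbey : n₁ < 2 * ρ + mstarOfRecord d) (hread : 2 * ρ + s + d % 2 = n₂) (hpar : 2 ∣ s) (hcap : 2 * ρ + 2 + d % 2 ≤ min n₁ n₃)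
    {eA : K} (hσeA : σ eA = eA) (heA1 : Valued.v eA = 1)
    (heA : Valued.v ((ϖ ^ mstarOfRecord d)⁻¹ * ((α - 1) * ((ϖ * σ ϖ) ^ ((n₂ - d % 2) / 2))⁻¹ - eA * ((ϖ - σ ϖ) * ((ϖ * σ ϖ) ^ ((d - d % 2) / 2))⁻¹))) ≤ 1)
    (i : Fin 3) :
    ∑ᶠ M ∈ {M : Submodule 𝒪[K] (Fin 3 → K) | M ∈ stratum σ ϖ T ![2 * ρ + s, 2 * ρ, 2 * ρ + s] ∧
        (LatticeInLevel ϖ (d % 2) (Matrix.diagonal ![α - 1, β - 1, 0]) M ∧ ¬ LatticeInLevel ϖ (d % 2 + 1) (Matrix.diagonal ![α - 1, β - 1, 0]) M ∧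
          LatticeInLevel ϖ (mcOfRecord d) (Matrix.diagonal ![(α - 1) * (α - 1), (β - 1) * (β - 1), 0]) M)},
      (labelledOddCount σ ϖ 0 i (valueClassLabel σ ϖ (α - 1) (β - 1) (mstarOfRecord d) d) M : ℚ) /
        ((((unitStabilizer M).map (unitNormMap σ 3)).relIndex (fixedUnitTorus σ 3) : ℕ) : ℚ) =
      (normSign σ eA : ℚ) / 2 * (Fintype.card 𝓀[K] : ℚ) ^ (2 * ρ + s / 2 - 1) *
        (![((if 2 * d + d % 2 + 2 * ρ ≤ n₁ then (Fintype.card 𝓀[K] : ℚ) - 1 else 0) - (if n₁ + 2 = 2 * d + d % 2 + 2 * ρ then 1 else 0)), (0 : ℚ),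
            (normSign σ (-1 : K) : ℚ) * ((if 2 * d + d % 2 + 2 * ρ ≤ n₃ then (Fintype.card 𝓀[K] : ℚ) - 1 else 0) -
              (if n₃ + 2 = 2 * d + d % 2 + 2 * ρ then 1 else 0))] : Fin 3 → ℚ) i := by
  -- the engine at (a, b, c) = (2ρ, 2ρ+s, 2ρ+s), witness type `K` (the token), `Hyp` = R3's side conditions, `F` = R3's value
  have key := finsum_stratum_shell_labelledOdd_div_relIndex_swap01_of hE hT 0 (2 * ρ) (2 * ρ + s) (2 * ρ + s) (d % 2) (d % 2 + 1)
    (mcOfRecord d) (mstarOfRecord d) d (W := K)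
    (fun α' β' n₁' n₂' n₃' eB => n₂' < 2 * ρ + mstarOfRecord d ∧ 2 * ρ + s + d % 2 = n₁' ∧ 2 ∣ s ∧ 2 * ρ + 2 + d % 2 ≤ min n₂' n₃' ∧
      σ eB = eB ∧ Valued.v eB = 1 ∧
      Valued.v ((ϖ ^ mstarOfRecord d)⁻¹ * ((β' - 1) * ((ϖ * σ ϖ) ^ ((n₁' - d % 2) / 2))⁻¹ - eB * ((ϖ - σ ϖ) * ((ϖ * σ ϖ) ^ ((d - d % 2) / 2))⁻¹))) ≤ 1)
    (fun α' β' n₁' n₂' n₃' eB i => (normSign σ eB : ℚ) / 2 * (Fintype.card 𝓀[K] : ℚ) ^ (2 * ρ + s / 2 - 1) *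
      (![(0 : ℚ), ((if 2 * d + d % 2 + 2 * ρ ≤ n₂' then (Fintype.card 𝓀[K] : ℚ) - 1 else 0) - (if n₂' + 2 = 2 * d + d % 2 + 2 * ρ then 1 else 0)),
          (normSign σ (-1 : K) : ℚ) * ((if 2 * d + d % 2 + 2 * ρ ≤ n₃' then (Fintype.card 𝓀[K] : ℚ) - 1 else 0) -
            (if n₃' + 2 = 2 * d + d % 2 + 2 * ρ then 1 else 0))] : Fin 3 → ℚ) i)
    (fun T' eB hE' hT' hHyp j => hR3 T' eB hE' hT' hHyp.1 hHyp.2.1 hHyp.2.2.1 hHyp.2.2.2.1 hHyp.2.2.2.2.1 hHyp.2.2.2.2.2.1 hHyp.2.2.2.2.2.2 j)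
    eA ⟨hbey, hread, hpar, hcap, hσeA, heA1, heA⟩ i
  rw [key]
  -- `(0, a, b)_{swap 0 1 i} = (a, 0, b)_i`
  fin_cases i <;> rfl

end Summit.HodgeConjecture.HodgeConjecture.Cruxes.H413.F0P3cDyRamLabelledOddBoundaryG2OfG1

end
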